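import Mathlib
import Summits.ResolutionOfSingularities.ResolutionOfSingularities.Theorems.WeightedInvariantLocalWeightedDropTOT2BridgePresByStep
import Summits.ResolutionOfSingularities.ResolutionOfSingularities.Theorems.WeightedInvariantLocalWeightedDropTOT2BridgePresByEntry
import Summits.ResolutionOfSingularities.ResolutionOfSingularities.Theorems.WeightedInvariantLocalWeightedDropNCResRegimeLetterAssembly
import Summits.ResolutionOfSingularities.ResolutionOfSingularities.Theorems.WeightedInvariantLocalWeightedDropNCResPresentationAdapter

/-!
# TOT2-LINE v1.3: THE REGIMES (P) AND (L) MODULO THE CONFLICT BUDGET (res-L1-w43-stub-2 g5)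

Sub-problem `ResolutionOfSingularities`, ENGINE crux `stmt-ResolutionOfSingularities-8899` (`LocalWeightedDrop`), skeleton v34
(80c4710965b6845c), registered stubs `stub_regimePresented` (P) and `stub_regimeLetter` (L).  The lead's assemblies
`regimePresented_of_pieces₂` / `regimeLetter_of_pieces` / `stub_regimeLetter_of_pieces` (…NCResRegimeLetterAssembly, res-L1-w43-lead-1 g5)
reduce both stubs to a piece list; every piece EXCEPT THE CONFLICT BUDGET is now a theorem of the tree:
`ψsel := PolyDescent.prepSelWP` (the lazy selector), `hsel := presBy_hsel_prepSelWP`, `hP1 := presBy_hP1` (…PresByEntry),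
`hPx := hPx_holds` (the lead's …NCResPresentationAdapter), `hP2′ := presBy_hP2'_prepSelWP`, `hP2c′ := presBy_hP2c'_prepSelWP` (…PresByStep).
This file performs the instantiation, leaving exactly res-type-088's budget `M` with its two laws `hM_succ` / `hM_conf` as hypotheses:
* `regimePresented_of_budget`, `regimeLetter_of_budget` — at a fixed algebraically closed field;
* **`stub_regimePresented_of_budget`**, **`stub_regimeLetter_of_budget`** — the registered statements under their binders, from the budget.

All statements are ours (engine bookkeeping); nothing here is a statement of [CJS] or [CP-char2].
-/

set_option linter.dupNamespace false -- mandated namespace of this single-conjunct summit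

noncomputable section

namespace Summit.ResolutionOfSingularities.ResolutionOfSingularities.Theorems

namespace TameFourTupleDrop

open MvPowerSeries Literature.AlgebraicGeometry.Resolution PolyDescent

section Field

variable {k : Type} [Field k] [IsAlgClosed k]

/-- **REGIME (P) MODULO THE BUDGET** (`k` algebraically closed): given a conflict budget `M` for the lazy selector with its two laws, every
admissible state of the `o ≥ 2` phase outside the apex column with an old letter or in good position is won towards «head drop, or same head
in the apex column». -/
theorem regimePresented_of_budget (M : (d : ℕ) → (Fin d → MvPowerSeries (Fin 2) k) → Finset (Fin 2) → ℕ)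
    (hM_succ : ∀ (d : ℕ) (A : Fin d → MvPowerSeries (Fin 2) k) (N : Finset (Fin 2)) (A' : Fin d → MvPowerSeries (Fin 2) k)
      (N' : Finset (Fin 2)),
      (∃ (b : MvPowerSeries (Fin (2 + 1)) k) (δ : Decoration k 2) (Θ : Fin (2 + 1) → MvPowerSeries (Fin (2 + 1)) k),
        Admissible b δ ∧ 2 ≤ δ.o ∧ δ.c = d ∧ δ.PresBy d A N Θ) →
      InPoly d A → InPoly d A' → SuccFamilySel d (prepSelWP d) A N A' N' → M d A' N' ≤ M d A N)
    (hM_conf : ∀ (d : ℕ) (A : Fin d → MvPowerSeries (Fin 2) k) (N : Finset (Fin 2)) (A' : Fin d → MvPowerSeries (Fin 2) k)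
      (N' : Finset (Fin 2)),
      (∃ (b : MvPowerSeries (Fin (2 + 1)) k) (δ : Decoration k 2) (Θ : Fin (2 + 1) → MvPowerSeries (Fin (2 + 1)) k),
        Admissible b δ ∧ 2 ≤ δ.o ∧ δ.c = d ∧ δ.PresBy d A N Θ) →
      InPoly d A → InPoly d A' → NCPoly.Conflict d A N → PointFamilySel d (prepSelWP d) A N A' N' → M d A' N' < M d A N)
    (b : MvPowerSeries (Fin (2 + 1)) k) (δ : Decoration k 2) (hadm : Admissible b δ) (ho : 2 ≤ δ.o) (hnc : ¬ δ.HCol)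
    (hreg : δ.O.Nonempty ∨ δ.GoodDir) :
    DWinsTo (St := MvPowerSeries (Fin (2 + 1)) k × Decoration k 2) Prod.fst
      (fun τ => Admissible τ.1 τ.2 ∧ (τ.2.head < δ.head ∨ (τ.2.head = δ.head ∧ τ.2.HCol))) (b, δ) :=
  regimePresented_of_pieces₂ (fun d => prepSelWP d) (fun d X hX => isPrepRecentring_prepSelWP_all d X hX) M hM_succ hM_conf
    (fun _ _ hadm ho hnot h => Decoration.exists_presBy_of_presented hadm ho hnot h)
    (fun _ _ _ _ _ _ hadm ho hcd hpres hWP hn => Decoration.hCol_of_presBy_of_not_inPoly hadm ho hcd hpres hWP hn)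
    (fun _ _ _ _ _ _ hadm ho hcd h hin hconf => h.exists_move_of_not_conflict hadm ho hcd hin hconf)
    (fun _ _ _ _ _ _ hadm ho hcd h hin _ => h.exists_move_point hadm ho hcd hin) b δ hadm ho hnc hreg

/-- **REGIME (L) MODULO THE BUDGET** (`k` algebraically closed): the same budget wins the letter regime towards «head drop, or same head in the
apex column / good position / bad position». -/
theorem regimeLetter_of_budget (M : (d : ℕ) → (Fin d → MvPowerSeries (Fin 2) k) → Finset (Fin 2) → ℕ)
    (hM_succ : ∀ (d : ℕ) (A : Fin d → MvPowerSeries (Fin 2) k) (N : Finset (Fin 2)) (A' : Fin d → MvPowerSeries (Fin 2) k)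
      (N' : Finset (Fin 2)),
      (∃ (b : MvPowerSeries (Fin (2 + 1)) k) (δ : Decoration k 2) (Θ : Fin (2 + 1) → MvPowerSeries (Fin (2 + 1)) k),
        Admissible b δ ∧ 2 ≤ δ.o ∧ δ.c = d ∧ δ.PresBy d A N Θ) →
      InPoly d A → InPoly d A' → SuccFamilySel d (prepSelWP d) A N A' N' → M d A' N' ≤ M d A N)
    (hM_conf : ∀ (d : ℕ) (A : Fin d → MvPowerSeries (Fin 2) k) (N : Finset (Fin 2)) (A' : Fin d → MvPowerSeries (Fin 2) k)
      (N' : Finset (Fin 2)),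
      (∃ (b : MvPowerSeries (Fin (2 + 1)) k) (δ : Decoration k 2) (Θ : Fin (2 + 1) → MvPowerSeries (Fin (2 + 1)) k),
        Admissible b δ ∧ 2 ≤ δ.o ∧ δ.c = d ∧ δ.PresBy d A N Θ) →
      InPoly d A → InPoly d A' → NCPoly.Conflict d A N → PointFamilySel d (prepSelWP d) A N A' N' → M d A' N' < M d A N)
    (b : MvPowerSeries (Fin (2 + 1)) k) (δ : Decoration k 2) (hadm : Admissible b δ) (ho : 2 ≤ δ.o) {l : Fin (2 + 1)}
    (hl : δ.LetterDir l) :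
    DWinsTo (St := MvPowerSeries (Fin (2 + 1)) k × Decoration k 2) Prod.fst
      (fun τ => Admissible τ.1 τ.2 ∧ (τ.2.head < δ.head ∨ (τ.2.head = δ.head ∧ (τ.2.HCol ∨ τ.2.GoodDir ∨ τ.2.BadDir)))) (b, δ) :=
  regimeLetter_of_pieces (fun d => prepSelWP d) (fun d X hX => isPrepRecentring_prepSelWP_all d X hX) M hM_succ hM_conf
    (fun _ _ hadm ho hnot h => Decoration.exists_presBy_of_presented hadm ho hnot h)
    (fun _ _ _ _ _ _ hadm ho hcd hpres hWP hn => Decoration.hCol_of_presBy_of_not_inPoly hadm ho hcd hpres hWP hn)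
    (fun _ _ _ _ _ _ hadm ho hcd h hin hconf => h.exists_move_of_not_conflict hadm ho hcd hin hconf)
    (fun _ _ _ _ _ _ hadm ho hcd h hin _ => h.exists_move_point hadm ho hcd hin) b δ hadm ho hl

end Field

/-! ## Under the registered stubs' binders -/

/-- **`stub_regimePresented` FROM THE BUDGET**: the registered statement of regime (P), given res-type-088's budget with its two laws for
the lazy selector. -/
theorem stub_regimePresented_of_budget
    (M : ∀ (k : Type) [Field k] (d : ℕ), (Fin d → MvPowerSeries (Fin 2) k) → Finset (Fin 2) → ℕ)
    (hM_succ : ∀ (p : ℕ), p.Prime → ∀ (k : Type) [Field k] [CharP k p] [IsAlgClosed k],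
      ∀ (d : ℕ) (A : Fin d → MvPowerSeries (Fin 2) k) (N : Finset (Fin 2)) (A' : Fin d → MvPowerSeries (Fin 2) k) (N' : Finset (Fin 2)),
      (∃ (b : MvPowerSeries (Fin 3) k) (δ : Decoration k 2) (Θ : Fin 3 → MvPowerSeries (Fin 3) k),
        Admissible b δ ∧ 2 ≤ δ.o ∧ δ.c = d ∧ δ.PresBy d A N Θ) →
      InPoly d A → InPoly d A' → SuccFamilySel d (prepSelWP (k := k) d) A N A' N' → M k d A' N' ≤ M k d A N)
    (hM_conf : ∀ (p : ℕ), p.Prime → ∀ (k : Type) [Field k] [CharP k p] [IsAlgClosed k],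
      ∀ (d : ℕ) (A : Fin d → MvPowerSeries (Fin 2) k) (N : Finset (Fin 2)) (A' : Fin d → MvPowerSeries (Fin 2) k) (N' : Finset (Fin 2)),
      (∃ (b : MvPowerSeries (Fin 3) k) (δ : Decoration k 2) (Θ : Fin 3 → MvPowerSeries (Fin 3) k),
        Admissible b δ ∧ 2 ≤ δ.o ∧ δ.c = d ∧ δ.PresBy d A N Θ) →
      InPoly d A → InPoly d A' → NCPoly.Conflict d A N → PointFamilySel d (prepSelWP (k := k) d) A N A' N' → M k d A' N' < M k d A N) :
    ∀ (p : ℕ), p.Prime → ∀ (k : Type) [Field k] [CharP k p] [IsAlgClosed k],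
      ∀ (b : MvPowerSeries (Fin 3) k) (δ : Decoration k 2), Admissible b δ → 2 ≤ δ.o → ¬ δ.HCol → (δ.O.Nonempty ∨ δ.GoodDir) →
        DWinsTo (St := MvPowerSeries (Fin 3) k × Decoration k 2) Prod.fst
          (fun τ => Admissible τ.1 τ.2 ∧ (τ.2.head < δ.head ∨ (τ.2.head = δ.head ∧ τ.2.HCol))) (b, δ) :=
  fun p hp k _ _ _ b δ hadm ho hnc hreg => regimePresented_of_budget (M k) (hM_succ p hp k) (hM_conf p hp k) b δ hadm ho hnc hreg

/-- **`stub_regimeLetter` FROM THE BUDGET**: the registered statement of regime (L), given res-type-088's budget with its two laws for the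
lazy selector (the lead's `stub_regimeLetter_of_pieces` with every other piece a tree theorem). -/
theorem stub_regimeLetter_of_budget
    (M : ∀ (k : Type) [Field k] (d : ℕ), (Fin d → MvPowerSeries (Fin 2) k) → Finset (Fin 2) → ℕ)
    (hM_succ : ∀ (p : ℕ), p.Prime → ∀ (k : Type) [Field k] [CharP k p] [IsAlgClosed k],
      ∀ (d : ℕ) (A : Fin d → MvPowerSeries (Fin 2) k) (N : Finset (Fin 2)) (A' : Fin d → MvPowerSeries (Fin 2) k) (N' : Finset (Fin 2)),
      (∃ (b : MvPowerSeries (Fin 3) k) (δ : Decoration k 2) (Θ : Fin 3 → MvPowerSeries (Fin 3) k),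
        Admissible b δ ∧ 2 ≤ δ.o ∧ δ.c = d ∧ δ.PresBy d A N Θ) →
      InPoly d A → InPoly d A' → SuccFamilySel d (prepSelWP (k := k) d) A N A' N' → M k d A' N' ≤ M k d A N)
    (hM_conf : ∀ (p : ℕ), p.Prime → ∀ (k : Type) [Field k] [CharP k p] [IsAlgClosed k],
      ∀ (d : ℕ) (A : Fin d → MvPowerSeries (Fin 2) k) (N : Finset (Fin 2)) (A' : Fin d → MvPowerSeries (Fin 2) k) (N' : Finset (Fin 2)),
      (∃ (b : MvPowerSeries (Fin 3) k) (δ : Decoration k 2) (Θ : Fin 3 → MvPowerSeries (Fin 3) k),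
        Admissible b δ ∧ 2 ≤ δ.o ∧ δ.c = d ∧ δ.PresBy d A N Θ) →
      InPoly d A → InPoly d A' → NCPoly.Conflict d A N → PointFamilySel d (prepSelWP (k := k) d) A N A' N' → M k d A' N' < M k d A N) :
    ∀ (p : ℕ), p.Prime → ∀ (k : Type) [Field k] [CharP k p] [IsAlgClosed k],
      ∀ (b : MvPowerSeries (Fin 3) k) (δ : Decoration k 2) (l : Fin 3), Admissible b δ → 2 ≤ δ.o → ¬ δ.HCol → δ.LetterDir l →
        DWinsTo (St := MvPowerSeries (Fin 3) k × Decoration k 2) Prod.fst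
          (fun τ => Admissible τ.1 τ.2 ∧ (τ.2.head < δ.head ∨ (τ.2.head = δ.head ∧ (τ.2.HCol ∨ τ.2.GoodDir ∨ τ.2.BadDir)))) (b, δ) :=
  stub_regimeLetter_of_pieces (fun k _ d => prepSelWP (k := k) d) presBy_hsel_prepSelWP M hM_succ hM_conf presBy_hP1 hPx_holds
    presBy_hP2'_prepSelWP presBy_hP2c'_prepSelWP

end TameFourTupleDrop

end Summit.ResolutionOfSingularities.ResolutionOfSingularities.Theorems

end
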